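import Mathlib
import Summits.ValiantsHypothesis.ValiantsHypothesis.Theorems.LacunarySymmetroidMatrixDescartesDefiniteMomentsWordLaw
import Summits.ValiantsHypothesis.ValiantsHypothesis.Theorems.LacunarySymmetroidMatrixDescartesDefiniteMomentsIndex

/-!
# `MatrixDescartes` (stmt-ValiantsHypothesis-18050) — the DEFINITE-MOMENTS LAW for sign words, RANK FORM: the two end
# windows pay the rank of the positive (resp. negative) letters, not the size

HONEST FRAMING.  Cell `pub-symmetroid`, seat `val-sym-mdr-p2` (gen 14); helper file `--supports` the crux
`Theses.LacunarySymmetroid.MatrixDescartes`, NO closure claim.  A refinement of `card_posRoots_le_of_wordMoments`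
(`…DefiniteMomentsWordLaw`) by the index form of the directed window (`…DefiniteMomentsIndex`); nothing here bears on the
crux in its window, on `stub_twoSided`, on `DoorA26`/`DoorA34`, registers, or `VP ≠ VNP`.

THE LAW (`card_posRoots_le_of_wordMoments_rank`).  Setting of the word law: semidefinite sign word with monotone block index
`β ≤ N + 2` on exponents (`(−1)^{β(dₖ)}Sₖ ⪰ 0`), interior moments `0 < t₀ < ⋯ < t_N` with `(−1)^{j+1}F(tⱼ) ≻ 0`.  If the
positively signed letters are dominated by a Gram factor of width `qp` (`∑_{β(dₖ) even} Sₖ ⪯ WpWpᵀ`) and the negatively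
signed ones by one of width `qn` (`−∑_{β(dₖ) odd} Sₖ ⪯ WnWnᵀ`), then
`Z₊ ≤ qp + N·card ι + (qp if N is even, qn if N is odd)`: the first window `(0, t₀)` carries at most `qp` zeros (its
kernel vectors span an `F(a)`-positive subspace at a scale `a` below all zeros, and `F(a) ⪯ (∑ a^{dₖ})·WpWpᵀ`), the last
window at most the index of the top sign, the `N` interior windows at most `card ι` each.  `V = 2` (`N = 0`):
`Z₊ ≤ 2qp` — the multi-letter version of `negMoment_posRoots_le_rank`; with rank-one letters, `q_± ≤` the number of
letters of that sign, so the end windows obey a Descartes-type count inside a K-free law.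
[folklore]; axioms `propext`, `Classical.choice`, `Quot.sound`; no definitions.
-/

-- layout Summits/ValiantsHypothesis/ValiantsHypothesis forces the duplicated namespace component
set_option linter.dupNamespace false

namespace Summit.ValiantsHypothesis.ValiantsHypothesis.Theorems.LacunarySymmetroidMatrixDescartes

open Polynomial Matrix Finset
open scoped BigOperators

namespace DefiniteMoments

section WordRank

variable {ι κ : Type} [Fintype ι] [DecidableEq ι] [Fintype κ]

omit [Fintype ι] [DecidableEq ι] in
/-- Scaling a Gram factor: `(√C•W)(√C•W)ᵀ = C•(W Wᵀ)` for `C ≥ 0`. [folklore] -/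
theorem sqrt_smul_gram {q : ℕ} (W : Matrix ι (Fin q) ℝ) {C : ℝ} (hC : 0 ≤ C) :
    (Real.sqrt C • W) * (Real.sqrt C • W)ᵀ = C • (W * Wᵀ) := by
  rw [Matrix.transpose_smul, Matrix.smul_mul, Matrix.mul_smul, smul_smul, Real.mul_self_sqrt hC]

omit [Fintype ι] [DecidableEq ι] in
/-- **The positive letters dominate the pencil from above**: with `(−1)^{β(dₖ)}Sₖ ⪰ 0` and
`∑_{β(dₖ) even} Sₖ ⪯ WpWpᵀ`, for every `a > 0`: `F(a) ⪯ (∑ₖ a^{dₖ})·WpWpᵀ`. [folklore] -/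
theorem eval_le_posGram (d : κ → ℕ) (S : κ → Matrix ι ι ℝ) (β : ℕ → ℕ)
    (hsign : ∀ k, (((-1 : ℝ) ^ β (d k)) • S k).PosSemidef) {q : ℕ} (W : Matrix ι (Fin q) ℝ)
    (hW : (W * Wᵀ - ∑ k ∈ Finset.univ.filter (fun k => Even (β (d k))), S k).PosSemidef) {a : ℝ} (ha : 0 < a) :
    ((∑ k, a ^ d k) • (W * Wᵀ) - ∑ k, a ^ d k • S k).PosSemidef := by
  set C : ℝ := ∑ k, a ^ d k with hC
  have hck : ∀ k, 0 ≤ a ^ d k := fun k => (pow_pos ha _).le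
  have hC0 : 0 ≤ C := Finset.sum_nonneg fun k _ => hck k
  have hCk : ∀ k, a ^ d k ≤ C := fun k => Finset.single_le_sum (f := fun k => a ^ d k) (fun k _ => hck k) (Finset.mem_univ k)
  have hpos : ∀ k, Even (β (d k)) → (S k).PosSemidef := fun k hk => by
    have h := hsign k; rwa [hk.neg_one_pow, one_smul] at h
  have hneg : ∀ k, ¬ Even (β (d k)) → (-S k).PosSemidef := fun k hk => by
    have h := hsign k; rwa [(Nat.not_even_iff_odd.1 hk).neg_one_pow, neg_smul, one_smul] at h
  have hsplit : ∑ k, a ^ d k • S k = ∑ k ∈ Finset.univ.filter (fun k => Even (β (d k))), a ^ d k • S k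
      + ∑ k ∈ Finset.univ.filter (fun k => ¬ Even (β (d k))), a ^ d k • S k :=
    (Finset.sum_filter_add_sum_filter_not _ _ _).symm
  have hdecomp : C • (W * Wᵀ) - ∑ k, a ^ d k • S k
      = C • (W * Wᵀ - ∑ k ∈ Finset.univ.filter (fun k => Even (β (d k))), S k)
        + ∑ k ∈ Finset.univ.filter (fun k => Even (β (d k))), (C - a ^ d k) • S k
        + ∑ k ∈ Finset.univ.filter (fun k => ¬ Even (β (d k))), a ^ d k • (-S k) := by
    rw [hsplit, smul_sub, Finset.smul_sum]
    simp only [sub_smul, smul_neg, Finset.sum_sub_distrib, Finset.sum_neg_distrib]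
    abel
  rw [hdecomp]
  refine Matrix.PosSemidef.add (Matrix.PosSemidef.add (hW.smul hC0) ?_) ?_
  · exact Matrix.posSemidef_sum _ fun k hk => (hpos k (Finset.mem_filter.1 hk).2).smul (sub_nonneg.2 (hCk k))
  · exact Matrix.posSemidef_sum _ fun k hk => (hneg k (Finset.mem_filter.1 hk).2).smul (hck k)

omit [Fintype ι] [DecidableEq ι] in
/-- **The negative letters dominate the pencil from below**: with `−∑_{β(dₖ) odd} Sₖ ⪯ WnWnᵀ`, for every `a > 0`:
`−F(a) ⪯ (∑ₖ a^{dₖ})·WnWnᵀ`. [folklore] -/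
theorem neg_eval_le_negGram (d : κ → ℕ) (S : κ → Matrix ι ι ℝ) (β : ℕ → ℕ)
    (hsign : ∀ k, (((-1 : ℝ) ^ β (d k)) • S k).PosSemidef) {q : ℕ} (W : Matrix ι (Fin q) ℝ)
    (hW : (W * Wᵀ + ∑ k ∈ Finset.univ.filter (fun k => ¬ Even (β (d k))), S k).PosSemidef) {a : ℝ} (ha : 0 < a) :
    ((∑ k, a ^ d k) • (W * Wᵀ) - ∑ k, a ^ d k • (-S k)).PosSemidef := by
  set C : ℝ := ∑ k, a ^ d k with hC
  have hck : ∀ k, 0 ≤ a ^ d k := fun k => (pow_pos ha _).le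
  have hC0 : 0 ≤ C := Finset.sum_nonneg fun k _ => hck k
  have hCk : ∀ k, a ^ d k ≤ C := fun k => Finset.single_le_sum (f := fun k => a ^ d k) (fun k _ => hck k) (Finset.mem_univ k)
  have hpos : ∀ k, Even (β (d k)) → (S k).PosSemidef := fun k hk => by
    have h := hsign k; rwa [hk.neg_one_pow, one_smul] at h
  have hneg : ∀ k, ¬ Even (β (d k)) → (-S k).PosSemidef := fun k hk => by
    have h := hsign k; rwa [(Nat.not_even_iff_odd.1 hk).neg_one_pow, neg_smul, one_smul] at h
  have hsplit : ∑ k, a ^ d k • (-S k) = ∑ k ∈ Finset.univ.filter (fun k => Even (β (d k))), a ^ d k • (-S k)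
      + ∑ k ∈ Finset.univ.filter (fun k => ¬ Even (β (d k))), a ^ d k • (-S k) :=
    (Finset.sum_filter_add_sum_filter_not _ _ _).symm
  have hdecomp : C • (W * Wᵀ) - ∑ k, a ^ d k • (-S k)
      = C • (W * Wᵀ + ∑ k ∈ Finset.univ.filter (fun k => ¬ Even (β (d k))), S k)
        + ∑ k ∈ Finset.univ.filter (fun k => ¬ Even (β (d k))), (C - a ^ d k) • (-S k)
        + ∑ k ∈ Finset.univ.filter (fun k => Even (β (d k))), a ^ d k • S k := by
    rw [hsplit, smul_add, Finset.smul_sum]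
    simp only [sub_smul, smul_neg, Finset.sum_sub_distrib, Finset.sum_neg_distrib]
    abel
  rw [hdecomp]
  refine Matrix.PosSemidef.add (Matrix.PosSemidef.add (hW.smul hC0) ?_) ?_
  · exact Matrix.posSemidef_sum _ fun k hk => (hneg k (Finset.mem_filter.1 hk).2).smul (sub_nonneg.2 (hCk k))
  · exact Matrix.posSemidef_sum _ fun k hk => (hpos k (Finset.mem_filter.1 hk).2).smul (hck k)

/-- **THE WORD LAW, RANK FORM.**  In the setting of `card_posRoots_le_of_wordMoments` (semidefinite sign word `β ≤ N+2`,
`N + 1` interior alternating definite moments), if `∑_{β(dₖ) even} Sₖ ⪯ WpWpᵀ` (`Wp : ι × Fin qp`) and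
`−∑_{β(dₖ) odd} Sₖ ⪯ WnWnᵀ` (`Wn : ι × Fin qn`), then
`Z₊ ≤ qp + N·card ι + (if N is even then qp else qn)`. [folklore] -/
theorem card_posRoots_le_of_wordMoments_rank (d : κ → ℕ) (S : κ → Matrix ι ι ℝ) (hS : ∀ k, (S k).IsSymm)
    (β : ℕ → ℕ) (hβ : Monotone β) (N : ℕ) (hβN : ∀ n, β n ≤ N + 2)
    (hsign : ∀ k, (((-1 : ℝ) ^ β (d k)) • S k).PosSemidef)
    (t : Fin (N + 1) → ℝ) (ht : StrictMono t) (ht0 : 0 < t 0)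
    (hdef : ∀ (j : Fin (N + 1)) (v : ι → ℝ), v ≠ 0 →
      0 < (-1 : ℝ) ^ ((j : ℕ) + 1) * (v ⬝ᵥ ((∑ k, t j ^ d k • S k) *ᵥ v)))
    (qp : ℕ) (Wp : Matrix ι (Fin qp) ℝ)
    (hWp : (Wp * Wpᵀ - ∑ k ∈ Finset.univ.filter (fun k => Even (β (d k))), S k).PosSemidef)
    (qn : ℕ) (Wn : Matrix ι (Fin qn) ℝ)
    (hWn : (Wn * Wnᵀ + ∑ k ∈ Finset.univ.filter (fun k => ¬ Even (β (d k))), S k).PosSemidef) :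
    ((Matrix.det (∑ k, ((X : ℝ[X]) ^ d k) • (S k).map C)).roots.toFinset.filter
        (fun x => 0 < x)).card ≤ qp + N * Fintype.card ι + (if Even N then qp else qn) := by
  set p := Matrix.det (∑ k, ((X : ℝ[X]) ^ d k) • (S k).map C) with hp
  by_cases hdet : p = 0
  · simp [hdet]
  have hdata := fun v hv => wordWindows d S β hβ N hβN hsign t ht ht0 hdef v hv
  have hmem_det : ∀ x : ℝ, x ∈ p.roots.toFinset → (∑ k, x ^ d k • S k).det = 0 := fun x hx =>
    det_eval_eq_zero_of_mem d S hx
  -- first window `(0, t₀)`: at most `qp` zeros (anchor below all of them)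
  have hfirst : (p.roots.toFinset.filter (fun x => 0 < x ∧ x < t 0)).card ≤ qp := by
    set R := p.roots.toFinset.filter (fun x => 0 < x ∧ x < t 0) with hR
    rcases Nat.eq_zero_or_pos R.card with h0 | hpos
    · rw [h0]; exact Nat.zero_le _
    let σ : Fin R.card ↪o ℝ := R.orderEmbOfFin rfl
    have hσmem : ∀ j, σ j ∈ R := fun j => R.orderEmbOfFin_mem rfl j
    have hσin : ∀ j, 0 < σ j ∧ σ j < t 0 := fun j => (Finset.mem_filter.1 (hσmem j)).2
    set a : ℝ := σ ⟨0, hpos⟩ / 2 with ha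
    have ha0 : 0 < a := by rw [ha]; linarith [(hσin ⟨0, hpos⟩).1]
    have hat : a < t 0 := by rw [ha]; linarith [(hσin ⟨0, hpos⟩).1, (hσin ⟨0, hpos⟩).2]
    have halt : ∀ x ∈ R, a < x := by
      intro x hx
      obtain ⟨j, hj⟩ : ∃ j, σ j = x := by
        have : x ∈ Set.range σ := by
          rw [Finset.range_orderEmbOfFin]; exact hx
        exact this
      have h1 : σ ⟨0, hpos⟩ ≤ σ j := σ.monotone (Fin.mk_le_mk.2 (Nat.zero_le _))
      rw [← hj, ha]; linarith [(hσin ⟨0, hpos⟩).1]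
    have hsub : R ⊆ p.roots.toFinset.filter (fun x => a < x ∧ x < t 0) := by
      intro x hx
      have hx' := Finset.mem_filter.1 hx
      exact Finset.mem_filter.2 ⟨hx'.1, halt x hx, hx'.2.2⟩
    refine (Finset.card_le_card hsub).trans ?_
    refine card_roots_filter_le_index_down d S hS (fun x => a < x ∧ x < t 0) a (fun x hx => hx.1) ?_ qp
      (Real.sqrt (∑ k, a ^ d k) • Wp) ?_
    · intro v hv s s' hs hs' hss' h
      have hs0 : 0 < s := by
        rcases hs with hs | hs
        · exact ha0.trans hs.1
        · rw [hs]; exact ha0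
      exact (hdata v hv).2.1 s s' hs0 hss' hs'.2 h
    · rw [sqrt_smul_gram Wp (Finset.sum_nonneg fun k _ => (pow_pos ha0 _).le)]
      exact eval_le_posGram d S β hsign Wp hWp ha0
  -- interior windows: at most `card ι` each (Theorem A)
  have hint : ∀ i : Fin N,
      (p.roots.toFinset.filter (fun x => t i.castSucc < x ∧ x < t i.succ)).card ≤ Fintype.card ι := by
    intro i
    refine card_roots_window_le d S hS ((-1 : ℝ) ^ ((i : ℕ) + 1)) ?_ ?_ (hdata · · |>.1 i)
    · intro v hv
      have h := hdef i.castSucc v hv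
      rwa [Fin.val_castSucc] at h
    · intro v hv
      have h := hdef i.succ v hv
      rw [Fin.val_succ, pow_succ] at h
      have e : (-1 : ℝ) ^ ((i : ℕ) + 1) * -1 * (v ⬝ᵥ ((∑ k, t i.succ ^ d k • S k) *ᵥ v))
          = -((-1 : ℝ) ^ ((i : ℕ) + 1) * (v ⬝ᵥ ((∑ k, t i.succ ^ d k • S k) *ᵥ v))) := by ring
      rw [e] at h
      linarith
  -- last window `(t_N, ∞)`: at most the index of the top sign (anchor above all zeros)
  have hlast : (p.roots.toFinset.filter (fun x => t (Fin.last N) < x)).card ≤ (if Even N then qp else qn) := by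
    set R := p.roots.toFinset.filter (fun x => t (Fin.last N) < x) with hR
    rcases Nat.eq_zero_or_pos R.card with h0 | hpos
    · rw [h0]; exact Nat.zero_le _
    let σ : Fin R.card ↪o ℝ := R.orderEmbOfFin rfl
    have hσmem : ∀ j, σ j ∈ R := fun j => R.orderEmbOfFin_mem rfl j
    have hσgt : ∀ j, t (Fin.last N) < σ j := fun j => (Finset.mem_filter.1 (hσmem j)).2
    set b : ℝ := σ ⟨R.card - 1, by omega⟩ + 1 with hb
    have hblt : ∀ x ∈ R, x < b := by
      intro x hx
      obtain ⟨j, hj⟩ : ∃ j, σ j = x := by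
        have : x ∈ Set.range σ := by rw [Finset.range_orderEmbOfFin]; exact hx
        exact this
      have h1 : σ j ≤ σ ⟨R.card - 1, by omega⟩ := σ.monotone (Fin.mk_le_mk.2 (by have := j.isLt; omega))
      rw [← hj, hb]; linarith
    have htb : t (Fin.last N) < b := (hσgt ⟨R.card - 1, by omega⟩).trans (hblt _ (hσmem _))
    have hb0 : 0 < b := (ht0.trans_le (ht.monotone (Fin.zero_le _))).trans htb
    have hsub : R ⊆ p.roots.toFinset.filter (fun x => t (Fin.last N) < x ∧ x < b) := by
      intro x hx
      have hx' := Finset.mem_filter.1 hx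
      exact Finset.mem_filter.2 ⟨hx'.1, hx'.2, hblt x hx⟩
    refine (Finset.card_le_card hsub).trans ?_
    -- forward positivity of `(−1)^N f` on the window (contrapositive of `wordWindows` (3))
    have hfwd : ∀ v : ι → ℝ, v ≠ 0 → ∀ s s' : ℝ, t (Fin.last N) < s → s < s' →
        0 ≤ (-1 : ℝ) ^ N * (v ⬝ᵥ ((∑ k, s ^ d k • S k) *ᵥ v)) →
        0 < (-1 : ℝ) ^ N * (v ⬝ᵥ ((∑ k, s' ^ d k • S k) *ᵥ v)) := by
      intro v hv s s' hs hss' h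
      by_contra hle
      push Not at hle
      have h3 := (hdata v hv).2.2 s s' hs hss'
      rw [pow_succ] at h3
      have h4 : 0 < (-1 : ℝ) ^ N * -1 * (v ⬝ᵥ ((∑ k, s ^ d k • S k) *ᵥ v)) := h3 (by nlinarith [hle])
      nlinarith [h, h4]
    rcases Nat.even_or_odd N with hN | hN
    · rw [if_pos hN]
      refine card_roots_filter_le_index_up d S hS (fun x => t (Fin.last N) < x ∧ x < b) b (fun x hx => hx.2) ?_ qp
        (Real.sqrt (∑ k, b ^ d k) • Wp) ?_
      · intro v hv s s' hs hs' hss' h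
        have h1 := hfwd v hv s s' hs.1 hss' (by rw [hN.neg_one_pow, one_mul]; exact h)
        rwa [hN.neg_one_pow, one_mul] at h1
      · rw [sqrt_smul_gram Wp (Finset.sum_nonneg fun k _ => (pow_pos hb0 _).le)]
        exact eval_le_posGram d S β hsign Wp hWp hb0
    · rw [if_neg (Nat.not_even_iff_odd.2 hN), ← roots_det_pencil_neg d S]
      refine card_roots_filter_le_index_up d (fun k => -S k) (fun k => (hS k).neg)
        (fun x => t (Fin.last N) < x ∧ x < b) b (fun x hx => hx.2) ?_ qn (Real.sqrt (∑ k, b ^ d k) • Wn) ?_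
      · intro v hv s s' hs hs' hss' h
        have e : ∀ x : ℝ, v ⬝ᵥ ((∑ k, x ^ d k • -S k) *ᵥ v) = -1 * (v ⬝ᵥ ((∑ k, x ^ d k • S k) *ᵥ v)) := by
          intro x
          rw [form_eq_sum, form_eq_sum, Finset.mul_sum]
          refine Finset.sum_congr rfl fun k _ => ?_
          rw [Matrix.neg_mulVec, dotProduct_neg]; ring
        rw [e] at h ⊢
        have h1 := hfwd v hv s s' hs.1 hss' (by rw [hN.neg_one_pow]; exact h)
        rwa [hN.neg_one_pow] at h1
      · rw [sqrt_smul_gram Wn (Finset.sum_nonneg fun k _ => (pow_pos hb0 _).le)]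
        exact neg_eval_le_negGram d S β hsign Wn hWn hb0
  -- no zero at a moment; the windows cover
  have hnot : ∀ (j : Fin (N + 1)) (x : ℝ), x ∈ p.roots.toFinset → x ≠ t j := by
    intro j x hx hxt
    subst hxt
    obtain ⟨v, hv, hFv⟩ := Matrix.exists_mulVec_eq_zero_iff.2 (hmem_det _ hx)
    have h := hdef j v hv
    rw [hFv, dotProduct_zero, mul_zero] at h
    exact lt_irrefl 0 h
  have hsub : p.roots.toFinset.filter (fun x => 0 < x) ⊆
      (p.roots.toFinset.filter (fun x => 0 < x ∧ x < t 0) ∪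
        (Finset.univ : Finset (Fin N)).biUnion
          (fun i => p.roots.toFinset.filter (fun x => t i.castSucc < x ∧ x < t i.succ))) ∪
        p.roots.toFinset.filter (fun x => t (Fin.last N) < x) := by
    intro x hx
    rw [Finset.mem_filter] at hx
    obtain ⟨hxr, hx0⟩ := hx
    rw [Finset.mem_union, Finset.mem_union, Finset.mem_biUnion]
    rcases lt_or_ge x (t 0) with h0 | h0
    · exact Or.inl (Or.inl (Finset.mem_filter.2 ⟨hxr, hx0, h0⟩))
    · rcases lt_or_ge (t (Fin.last N)) x with hL | hL
      · exact Or.inr (Finset.mem_filter.2 ⟨hxr, hL⟩)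
      · have h0' : t 0 < x := lt_of_le_of_ne h0 (fun h => hnot 0 x hxr h.symm)
        have hL' : x < t (Fin.last N) := lt_of_le_of_ne hL (hnot _ x hxr)
        obtain ⟨i, hi1, hi2⟩ := exists_gap_of_between t h0' hL' (fun j => hnot j x hxr)
        exact Or.inl (Or.inr ⟨i, Finset.mem_univ _, Finset.mem_filter.2 ⟨hxr, hi1, hi2⟩⟩)
  calc (p.roots.toFinset.filter (fun x => 0 < x)).card
      ≤ ((p.roots.toFinset.filter (fun x => 0 < x ∧ x < t 0) ∪
          (Finset.univ : Finset (Fin N)).biUnion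
            (fun i => p.roots.toFinset.filter (fun x => t i.castSucc < x ∧ x < t i.succ))) ∪
          p.roots.toFinset.filter (fun x => t (Fin.last N) < x)).card := Finset.card_le_card hsub
    _ ≤ ((p.roots.toFinset.filter (fun x => 0 < x ∧ x < t 0)).card +
          ((Finset.univ : Finset (Fin N)).biUnion
            (fun i => p.roots.toFinset.filter (fun x => t i.castSucc < x ∧ x < t i.succ))).card) +
          (p.roots.toFinset.filter (fun x => t (Fin.last N) < x)).card :=
        (Finset.card_union_le _ _).trans (Nat.add_le_add_right (Finset.card_union_le _ _) _)
    _ ≤ (qp + ∑ i : Fin N, Fintype.card ι) + (if Even N then qp else qn) := by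
        refine Nat.add_le_add (Nat.add_le_add hfirst (Finset.card_biUnion_le.trans ?_)) hlast
        exact Finset.sum_le_sum fun i _ => hint i
    _ = qp + N * Fintype.card ι + (if Even N then qp else qn) := by
        rw [Finset.sum_const, Finset.card_univ, Fintype.card_fin, smul_eq_mul]

end WordRank

end DefiniteMoments

end Summit.ValiantsHypothesis.ValiantsHypothesis.Theorems.LacunarySymmetroidMatrixDescartes
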